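import Summits.HubbardSuperconductivity.HubbardSuperconductivity.Theorems.AnisotropyChordTotalSpinTransfer
import Summits.HubbardSuperconductivity.HubbardSuperconductivity.Theorems.AnisotropyChordInsertionEntropyUniformDensity

/-!
# Route `AnisotropyChord` / H0 rotor rung: the support statement `PerronZeroOfInt Δ` PROVED (every `Δ`), and the
# conditional record rung «XY-LM₀ ∧ half-filling anchor ⇒ condensation on a band» with it substituted
# (work-order v11b of theory seat `hubbard-h0-rotor-theory-1`, cycle 11; director ruling 2026-08-28T13:48:19Z (a))

If an INTEGER sector `Sᶻ_tot = M` of `H(Δ)` on `(ℤ/L)²` carries a Perron ground amplitude, then `L²` is even and the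
half-filling sector `Sᶻ_tot = 0` carries one: the sector value is `L²/2 − W` for an attained weight `W`
(`exists_weight_of_mem_spinZSector`), so `L² = 2(M + W)`; a configuration of weight `L²/2` exists
(`exists_config_weight_eq`), its basis vector lies in the sector `0` (`LiebMattis.mem_spinZSector_weight_iff`), and the
reducible Perron–Frobenius theorem of the tree (`exists_perronAmplitude`) gives the amplitude.

* **`perronZeroOfInt_holds : ∀ Δ, PerronZeroOfInt Δ`**;
* `condensateOnBand_of_minSpinAtZero'`, `condensateOnBand_of_totalSpinMonotone'`, `condensateOnBand_of_minSpinAtZeroUpTo'`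
  — the theory seat's conditional rung with the support hypothesis discharged:
  «`MinSpinAtZeroUpTo Δ ε ∧ HalfFillingAnchor Δ c₀ ⇒ CondensateOnBand Δ (min(c₀/4,1/4)) (c₀/2 − ε)`».
-/

set_option linter.dupNamespace false
set_option autoImplicit false

noncomputable section

open Finset Filter Topology
open Summit.HubbardSuperconductivity.HubbardSuperconductivity.Theorems.AnisotropyChord.InsertionEntropy
open Literature.MathematicalPhysics.QuantumLattice Literature.Probability.LatticeModels

namespace Summit.HubbardSuperconductivity.HubbardSuperconductivity.Theorems.AnisotropyChord.Tower

/-- **An integer sector with a Perron ground amplitude forces the half-filling sector to be non-trivial.** [folklore] -/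
theorem sectorZero_ne_bot_of_perron (L : ℕ) [NeZero L] (Δ : ℝ) (M : ℤ) (a : TensorIndex (TorusSite 2 L) 2 → ℝ)
    (ha : IsPerronSectorGroundAmplitude L Δ (M : ℝ) a) : spinZSector (Λ := TorusSite 2 L) 1 (0 : ℝ) ≠ ⊥ := by
  set ψ : TensorIndex (TorusSite 2 L) 2 → ℂ := fun s => (a s : ℂ) with hψ
  have hψ0 : ψ ≠ 0 := by
    intro h0
    have hz : ∑ σ, a σ ^ 2 = 0 := Finset.sum_eq_zero fun σ _ => by
      have := congrFun h0 σ
      simp only [hψ, Pi.zero_apply, Complex.ofReal_eq_zero] at this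
      rw [this]; ring
    rw [ha.unit] at hz
    exact one_ne_zero hz
  obtain ⟨W, ⟨σ₁, hσ₁⟩, hMW⟩ := exists_weight_of_mem_spinZSector ha.sector hψ0
  have hcard : Fintype.card (TorusSite 2 L) = L ^ 2 := by
    rw [Fintype.card_fun, ZMod.card, Fintype.card_fin]
  -- `W ≤ L²`
  have hWle : W ≤ L ^ 2 := by
    rw [← hσ₁, ← hcard, ← Finset.card_univ]
    calc (∑ z, (σ₁ z : ℕ)) ≤ ∑ _z : TorusSite 2 L, 1 :=
          Finset.sum_le_sum fun z _ => by have := (σ₁ z).isLt; omega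
      _ = Finset.univ.card := by simp
  -- `L² = 2 (M + W)`, hence `L²/2 · 2 = L²`
  have hMWr : (M : ℝ) = ((L ^ 2 : ℕ) : ℝ) / 2 - (W : ℝ) := by
    rw [hMW, hcard]; push_cast; ring
  have heven : 2 * (L ^ 2 / 2) = L ^ 2 := by
    have h2 : ((L ^ 2 : ℕ) : ℝ) = 2 * ((M : ℝ) + W) := by linarith
    have h3 : ((L ^ 2 : ℕ) : ℤ) = 2 * (M + (W : ℤ)) := by exact_mod_cast h2
    have h4 : (2 : ℤ) ∣ ((L ^ 2 : ℕ) : ℤ) := ⟨M + W, h3⟩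
    have h5 : 2 ∣ L ^ 2 := by exact_mod_cast Int.natCast_dvd_natCast.mp h4
    exact Nat.mul_div_cancel' h5
  -- a configuration of weight `L²/2`; its basis vector lies in the sector `0`
  obtain ⟨σ₀, hσ₀⟩ :=
    Summit.AtomisticToContinuum.BoseEinsteinCondensation.Theorems.BECStronglyRayleighSectorPerron.exists_config_weight_eq
      2 L (L ^ 2 / 2) (Nat.div_le_self _ _)
  have hsec0 : ((Fintype.card (TorusSite 2 L) * 1 : ℕ) : ℝ) / 2 - ((L ^ 2 / 2 : ℕ) : ℝ) = 0 := by
    rw [hcard]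
    have : ((L ^ 2 * 1 : ℕ) : ℝ) = 2 * ((L ^ 2 / 2 : ℕ) : ℝ) := by
      rw [mul_one]; exact_mod_cast heven.symm
    rw [this]; ring
  set φ : TensorIndex (TorusSite 2 L) 2 → ℂ := fun s => if s = σ₀ then 1 else 0 with hφ
  have hφK : φ ∈ spinZSector (Λ := TorusSite 2 L) 1 (0 : ℝ) := by
    rw [← hsec0]
    refine (LiebMattis.mem_spinZSector_weight_iff 1 (L ^ 2 / 2) φ).2 fun s hs => ?_
    have hsσ : s ≠ σ₀ := by rintro rfl; exact hs hσ₀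
    simp [hφ, hsσ]
  intro hbot
  rw [hbot, Submodule.mem_bot] at hφK
  have := congrFun hφK σ₀
  simp [hφ] at this

/-- **`PerronZeroOfInt Δ` holds for every `Δ`** (support statement of the theory seat's conditional rung,
memo ROTOR-THEORY-11 §151). [folklore] -/
theorem perronZeroOfInt_holds (Δ : ℝ) : PerronZeroOfInt Δ := by
  intro L _ M a ha
  exact exists_perronAmplitude L Δ 0 (sectorZero_ne_bot_of_perron L Δ M a ha)

/-- **CONDITIONAL RECORD RUNG, support discharged:** `XY-LM₀ ∧` half-filling anchor `c₀ ⇒` condensate density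
`≥ c₀/2` on the band `|M| ≤ min(c₀/4, 1/4)·|V|`. [folklore] -/
theorem condensateOnBand_of_minSpinAtZero' (Δ c₀ : ℝ) (hc₀ : 0 < c₀) (hmin : MinSpinAtZero Δ)
    (hA : HalfFillingAnchor Δ c₀) : CondensateOnBand Δ (min (c₀ / 4) (1 / 4)) (c₀ / 2) :=
  condensateOnBand_of_minSpinAtZero Δ c₀ hc₀ hmin (perronZeroOfInt_holds Δ) hA

/-- Monotone form, support discharged. [folklore] -/
theorem condensateOnBand_of_totalSpinMonotone' (Δ c₀ : ℝ) (hc₀ : 0 < c₀) (hmono : TotalSpinMonotone Δ)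
    (hA : HalfFillingAnchor Δ c₀) : CondensateOnBand Δ (min (c₀ / 4) (1 / 4)) (c₀ / 2) :=
  condensateOnBand_of_totalSpinMonotone Δ c₀ hc₀ hmono (perronZeroOfInt_holds Δ) hA

/-- **Robust form, support discharged (the booked conditional rung, director ruling 2026-08-28T13:48:19Z (a)):**
`MinSpinAtZeroUpTo Δ ε ∧ HalfFillingAnchor Δ c₀ ⇒ CondensateOnBand Δ (min(c₀/4, 1/4)) (c₀/2 − ε)`. [folklore] -/
theorem condensateOnBand_of_minSpinAtZeroUpTo' (Δ c₀ ε : ℝ) (hc₀ : 0 < c₀) (hmin : MinSpinAtZeroUpTo Δ ε)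
    (hA : HalfFillingAnchor Δ c₀) : CondensateOnBand Δ (min (c₀ / 4) (1 / 4)) (c₀ / 2 - ε) :=
  condensateOnBand_of_minSpinAtZeroUpTo Δ c₀ ε hc₀ hmin (perronZeroOfInt_holds Δ) hA

end Summit.HubbardSuperconductivity.HubbardSuperconductivity.Theorems.AnisotropyChord.Tower
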